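import Literature.AlgebraicGeometry.ShimuraVarieties.UnitaryCurveConeReadClassInjective
import Literature.AlgebraicGeometry.ShimuraVarieties.UnitaryShimuraCurveConeReadSlices
import Literature.NumberTheory.Automorphic.UnitaryCurveCohCotangentForms
import Summits.HodgeConjecture.CorCM.HypLiu418.AlbaneseH1ComparisonOfLemma24
import HarnessLib

/-!
# Crux `HLiu418`, line `F0_AlbCm`, stub `stub_S1_levelRealisation` — leg R6c (record level): a class in `H¹` of a curve covered by
# ball-quotient PIECES is detected by the piece functions of its `(1,0)`-form and of the `(1,0)`-form of its conjugate

Floor-0 programme P5 (Alb-CM), seat A-p14 (g15); item stmt-HodgeConjecture-24832 (`HCCMUnconditional.HLiu418`), sub-sub-line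
`Cruxes/HLiu418/Lines/F0_AlbCmS1Betti` (letter `S1LevelRealisationShape`).  THEOREMS ONLY (no definition, no named fact, no `sorry`);
`--supports stmt-HodgeConjecture-24832`.  HC_CM is proved only modulo the 7 printed citations until rung 0 closes; nothing printed is
asserted here.

This is the INJECTIVITY socket (I) = R6c of the record-side levelwise realisation (M5-rec design memo `DESIGN-M5rec` §1, consumed by the
M5-glue assembly `F0AlbCmS1LevelRealisation` of F0P5-p01 (g0)), stated S-FREE over a generic cofan of pieces so that the assembly
instantiates it with the data `(gq, hgq, X, ι, hcol, B, hB)` of `RecordSystemGS.pieces K` (`M' := (M_K) ⊗_{L,τ} ℂ`,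
`A q := algebraicModel (B q).isSmoothProjective`, `hcl q := (A q).holFormsClosed_top`):
* `complexBetti_eq_zero_of_forall_coneRead_archLocal_eq_zero` — for a colimit cofan `ι q : X q ⟶ M'` of `ℂ`-schemes whose legs are compact
  unitary Shimura CURVES uniformised by data `B q` with `(B q).Hℂ = J⋆^τ`, Hodge models `A q` with closed holomorphic `1`-forms, a frame
  `v₀ ∈ 𝒞⁻(J⋆^τ)`, `t₀ ∉ ℂ v₀`, and a class `z ∈ H¹(M'(ℂ); ℂ)`: if for every piece `q` and every `u` of the archimedean factor
  `U(σ_{mk τ} J⋆)(ℂ)` the cone reads at `(ũ v₀, ũ t₀)` (`ũ := embTwist_τ(u)`) of the `(1,0)`-forms `ω_q(ι_q(ℂ)^* z)` AND `ω_q(ι_q(ℂ)^* z̄)`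
  vanish — i.e. the piece functions of the adelic lifts `Φ^{10}[z]`, `Φ^{10}[z̄]` vanish (★ `UnitaryGroup.lift_eq_zero_iff`) — then `z = 0`.
  Proof: per piece ★ R6c `UnitaryBallUniformisationDatum.eq_zero_of_forall_coneRead_archLocal_eq_zero` (after moving the conjugation
  through `ι_q(ℂ)^*`, ★ `conjClass_complexBetti_map`) gives `ι_q(ℂ)^* z = 0` for every `q`, and a class is determined by its restrictions to
  the legs of a colimit cofan (★ `D2Bridge.complexBetti_eq_zero_of_forall_map_inj`).
* `complexBetti_eq_zero_of_forall_coneRead_unitary_eq_zero` — the same with the group quantified as `g ∈ GL₂(ℂ)`, `gᴴ J⋆^τ g = J⋆^τ`.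
* `complexBetti_eq_zero_of_forall_coneRead_archLocal_eq_zero_of_coneFrame` — the same with the frame given as the UNTWIST `(v₀, t₀)` of a
  cone frame `𝔣 : ConeFrame L J⋆ (cmPlace L τ)` (`𝔣.v₀ = embTwist ∘ v₀`, `𝔣.t₀ = embTwist ∘ t₀` — the binders of ★ `lift_mem_cohForms₂`):
  `v₀` is then negative for `J⋆^τ` (★ `mem_negCone_of_embTwist_eq`) and `t₀ ∉ ℂ v₀` (`coneFrame_untwist_ne_smul`: a positive vector is not a
  multiple of a negative one, `ne_smul_of_re_neg_of_re_pos`).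

## References
* [Borel1997] A. Borel, *Automorphic forms on SL₂(ℝ)* (1997), §5.14.
* [VoisinHodgeI2002] C. Voisin, *Hodge Theory and Complex Algebraic Geometry I* (2002), §6.1.3 Cor. 6.12 ∕ 6.14, §7.1.1 Cor. 7.6.
* [HatcherAT2002] A. Hatcher, *Algebraic Topology* (2002), §3.1 p. 202 (cohomology of a disjoint union).
* [BergeronMillsonMoeglin2016Balls] N. Bergeron, J. Millson, C. Moeglin, Acta Math. 216 (2016), Part 2 §1.3 (negative cone, frames).
-/

set_option autoImplicit false
set_option linter.dupNamespace false

noncomputable section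

open Matrix Function NumberField CategoryTheory CategoryTheory.Limits
open scoped Manifold Topology Matrix ComplexOrder
open Literature.Geometry.Kaehler (MForm)
open Literature.AlgebraicGeometry.HodgeTheory
open Literature.AlgebraicGeometry.Motives (SchemeOver ComplexPoints)
open Literature.AlgebraicGeometry.ShimuraVarieties Literature.AlgebraicGeometry.ShimuraVarieties.UnitaryCanonicalModel
open Literature.NumberTheory.Automorphic Literature.NumberTheory.Automorphic.UnitaryGroup
open Literature.NumberTheory.Automorphic.UnitaryCurveForms (ConeFrame)
open Summit.HodgeConjecture.CorCM.D2Bridge (complexBetti_eq_zero_of_forall_map_inj)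

namespace Summit.HodgeConjecture.HodgeConjecture.Cruxes.HLiu418.RecordClassDetection

variable {L : Type} [Field L] [NumberField L] [IsCMField L] {Jstar : Matrix (Fin 2) (Fin 2) L} {τ : L →+* ℂ}
  {Q : Type} {X : Q → SchemeOver ℂ} {M' : SchemeOver ℂ} {ι : ∀ q, X q ⟶ M'}

/-! ### §0 Frame bookkeeping: the untwist of a cone frame is a frame for `J⋆^τ` -/

/-- A POSITIVE vector is not a multiple of a NEGATIVE one: if `re ⟨v, J v⟩ < 0` and `re ⟨t, J t⟩ > 0` then `t ∉ ℂ v`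
(`⟨c v, J (c v)⟩ = |c|² ⟨v, J v⟩`). [cite: BergeronMillsonMoeglin2016Balls, Part 2 §1.3] -/
theorem ne_smul_of_re_neg_of_re_pos {n : ℕ} (J : Matrix (Fin n) (Fin n) ℂ) {v t : Fin n → ℂ}
    (hv : (star v ⬝ᵥ (J *ᵥ v)).re < 0) (ht : 0 < (star t ⬝ᵥ (J *ᵥ t)).re) (c : ℂ) : t ≠ c • v := by
  intro htc
  rw [htc, star_smul, Matrix.mulVec_smul, smul_dotProduct, dotProduct_smul, smul_eq_mul, smul_eq_mul, ← mul_assoc,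
    Complex.star_def, ← Complex.normSq_eq_conj_mul_self, Complex.re_ofReal_mul] at ht
  nlinarith [Complex.normSq_nonneg c]

/-- **The untwist `(v₀, t₀)` of a cone frame `𝔣` at the place of `τ` has `t₀ ∉ ℂ v₀`**: `𝔣.t₀` is positive and `𝔣.v₀` negative for
`σ_{mk τ}(J⋆)`, and `t₀ = c v₀` would give `𝔣.t₀ = embTwist(c) 𝔣.v₀`. [cite: BergeronMillsonMoeglin2016Balls, Part 2 §1.3] -/
theorem coneFrame_untwist_ne_smul (𝔣 : ConeFrame L Jstar (cmPlace L τ)) {v₀ t₀ : Fin 2 → ℂ}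
    (hv : 𝔣.v₀ = fun i => embTwist L τ (v₀ i)) (ht : 𝔣.t₀ = fun i => embTwist L τ (t₀ i)) (c : ℂ) : t₀ ≠ c • v₀ := by
  intro htc
  have h1 : 𝔣.t₀ = embTwist L τ c • 𝔣.v₀ := by
    rw [ht, hv]
    funext i
    simp only [htc, Pi.smul_apply, smul_eq_mul, map_mul]
  exact ne_smul_of_re_neg_of_re_pos _ 𝔣.v₀_mem 𝔣.t₀_pos _ h1

/-- **The untwist `v₀` of the base vector of a cone frame at the place of `τ` is negative for `J⋆^τ`** (★ `mem_negCone_of_embTwist_eq`).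
[cite: BergeronMillsonMoeglin2016Balls, Part 2 §1.3] -/
theorem coneFrame_untwist_mem_negCone (𝔣 : ConeFrame L Jstar (cmPlace L τ)) {v₀ : Fin 2 → ℂ}
    (hv : 𝔣.v₀ = fun i => embTwist L τ (v₀ i)) : v₀ ∈ negCone (Jstar.map τ) :=
  mem_negCone_of_embTwist_eq τ (isComplex_mk_of_isCMField L τ) Jstar hv 𝔣.v₀_mem

/-! ### §1 R6c at the record level -/

/-- **R6c (record level, adelic currency).**  For a colimit cofan `ι q : X q ⟶ M'` of compact unitary Shimura curves uniformised by `B q`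
with `(B q).Hℂ = J⋆^τ`, Hodge models `A q` with closed holomorphic `1`-forms, a frame `v₀ ∈ 𝒞⁻(J⋆^τ)`, `t₀ ∉ ℂ v₀`, and `z ∈ H¹(M'(ℂ); ℂ)`: if
the cone reads of `ω_q(ι_q(ℂ)^* z)` and of `ω_q(ι_q(ℂ)^* z̄)` vanish at `(ũ v₀, ũ t₀)` for every piece `q` and every `u ∈ U(σ_{mk τ} J⋆)(ℂ)`
(`ũ := embTwist_τ(u)`), then `z = 0` (per piece ★ R6c, conjugation moved through `ι_q(ℂ)^*`, then cofan detection).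
[cite: Borel1997, §5.14] [cite: VoisinHodgeI2002, §6.1.3 Cor. 6.14] [cite: HatcherAT2002, §3.1 p. 202] -/
theorem complexBetti_eq_zero_of_forall_coneRead_archLocal_eq_zero (hcol : IsColimit (Cofan.mk M' ι))
    (B : ∀ q, UnitaryBallUniformisationDatum 1 (X q)) (hH : ∀ q, (B q).Hℂ = Jstar.map τ)
    (A : ∀ q, HodgeModel 1 (X q)) (hcl : ∀ q, (A q).HolFormsClosed 1)
    {v₀ t₀ : Fin 2 → ℂ} (hv₀ : v₀ ∈ negCone (Jstar.map τ)) (hvt : ∀ c : ℂ, t₀ ≠ c • v₀) (z : complexBetti M' 1)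
    (h10 : ∀ (q : Q) (u : archLocal L 2 Jstar (cmPlace L τ)),
      (((A q).oneFormOfClass (B q).isSmoothProjective (hcl q)
            (((A q).complexification (B q).isSmoothProjective 1).symm
              ((A q).pullbackEquiv 1 ((A q).typeProj 1 ⟨(1, 0), Finset.HasAntidiagonal.mem_antidiagonal.2 rfl⟩
                (complexBetti.map (ι q) 1 z))))) :
          MForm 𝓘(ℝ, (A q).model) (A q).carrier ℂ 1)
        ((⇑(A q).isAnalytification.homeomorph.symm ∘ (B q).unif)
          ((((u : GL (Fin 2) ℂ) : Matrix (Fin 2) (Fin 2) ℂ).map (embTwist L τ)) *ᵥ v₀))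
        (fun _ ↦ mfderiv 𝓘(ℝ, Fin 2 → ℂ) 𝓘(ℝ, (A q).model) (⇑(A q).isAnalytification.homeomorph.symm ∘ (B q).unif)
          ((((u : GL (Fin 2) ℂ) : Matrix (Fin 2) (Fin 2) ℂ).map (embTwist L τ)) *ᵥ v₀)
          ((((u : GL (Fin 2) ℂ) : Matrix (Fin 2) (Fin 2) ℂ).map (embTwist L τ)) *ᵥ t₀)) = 0)
    (h01 : ∀ (q : Q) (u : archLocal L 2 Jstar (cmPlace L τ)),
      (((A q).oneFormOfClass (B q).isSmoothProjective (hcl q)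
            (((A q).complexification (B q).isSmoothProjective 1).symm
              ((A q).pullbackEquiv 1 ((A q).typeProj 1 ⟨(1, 0), Finset.HasAntidiagonal.mem_antidiagonal.2 rfl⟩
                (complexBetti.map (ι q) 1 (conjClass (ComplexPoints M') 1 z)))))) :
          MForm 𝓘(ℝ, (A q).model) (A q).carrier ℂ 1)
        ((⇑(A q).isAnalytification.homeomorph.symm ∘ (B q).unif)
          ((((u : GL (Fin 2) ℂ) : Matrix (Fin 2) (Fin 2) ℂ).map (embTwist L τ)) *ᵥ v₀))
        (fun _ ↦ mfderiv 𝓘(ℝ, Fin 2 → ℂ) 𝓘(ℝ, (A q).model) (⇑(A q).isAnalytification.homeomorph.symm ∘ (B q).unif)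
          ((((u : GL (Fin 2) ℂ) : Matrix (Fin 2) (Fin 2) ℂ).map (embTwist L τ)) *ᵥ v₀)
          ((((u : GL (Fin 2) ℂ) : Matrix (Fin 2) (Fin 2) ℂ).map (embTwist L τ)) *ᵥ t₀)) = 0) :
    z = 0 := by
  refine complexBetti_eq_zero_of_forall_map_inj hcol fun q ↦ ?_
  refine (B q).eq_zero_of_forall_coneRead_archLocal_eq_zero (A q) (hcl q) (hH q) hv₀ hvt _ (h10 q) ?_
  rw [conjClass_complexBetti_map]
  exact h01 q

omit [NumberField L] [IsCMField L] in
/-- **R6c (record level, `GL₂(ℂ)` currency).**  The same with the vanishing asked at every `g ∈ GL₂(ℂ)` with `gᴴ J⋆^τ g = J⋆^τ`.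
[cite: Borel1997, §5.14] [cite: VoisinHodgeI2002, §6.1.3 Cor. 6.14] [cite: HatcherAT2002, §3.1 p. 202] -/
theorem complexBetti_eq_zero_of_forall_coneRead_unitary_eq_zero (hcol : IsColimit (Cofan.mk M' ι))
    (B : ∀ q, UnitaryBallUniformisationDatum 1 (X q)) (hH : ∀ q, (B q).Hℂ = Jstar.map τ)
    (A : ∀ q, HodgeModel 1 (X q)) (hcl : ∀ q, (A q).HolFormsClosed 1)
    {v₀ t₀ : Fin 2 → ℂ} (hv₀ : v₀ ∈ negCone (Jstar.map τ)) (hvt : ∀ c : ℂ, t₀ ≠ c • v₀) (z : complexBetti M' 1)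
    (h10 : ∀ (q : Q) (g : GL (Fin 2) ℂ), (g : Matrix (Fin 2) (Fin 2) ℂ)ᴴ * Jstar.map τ * (g : Matrix (Fin 2) (Fin 2) ℂ) = Jstar.map τ →
      (((A q).oneFormOfClass (B q).isSmoothProjective (hcl q)
            (((A q).complexification (B q).isSmoothProjective 1).symm
              ((A q).pullbackEquiv 1 ((A q).typeProj 1 ⟨(1, 0), Finset.HasAntidiagonal.mem_antidiagonal.2 rfl⟩
                (complexBetti.map (ι q) 1 z))))) :
          MForm 𝓘(ℝ, (A q).model) (A q).carrier ℂ 1)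
        ((⇑(A q).isAnalytification.homeomorph.symm ∘ (B q).unif) ((g : Matrix (Fin 2) (Fin 2) ℂ) *ᵥ v₀))
        (fun _ ↦ mfderiv 𝓘(ℝ, Fin 2 → ℂ) 𝓘(ℝ, (A q).model) (⇑(A q).isAnalytification.homeomorph.symm ∘ (B q).unif)
          ((g : Matrix (Fin 2) (Fin 2) ℂ) *ᵥ v₀) ((g : Matrix (Fin 2) (Fin 2) ℂ) *ᵥ t₀)) = 0)
    (h01 : ∀ (q : Q) (g : GL (Fin 2) ℂ), (g : Matrix (Fin 2) (Fin 2) ℂ)ᴴ * Jstar.map τ * (g : Matrix (Fin 2) (Fin 2) ℂ) = Jstar.map τ →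
      (((A q).oneFormOfClass (B q).isSmoothProjective (hcl q)
            (((A q).complexification (B q).isSmoothProjective 1).symm
              ((A q).pullbackEquiv 1 ((A q).typeProj 1 ⟨(1, 0), Finset.HasAntidiagonal.mem_antidiagonal.2 rfl⟩
                (complexBetti.map (ι q) 1 (conjClass (ComplexPoints M') 1 z)))))) :
          MForm 𝓘(ℝ, (A q).model) (A q).carrier ℂ 1)
        ((⇑(A q).isAnalytification.homeomorph.symm ∘ (B q).unif) ((g : Matrix (Fin 2) (Fin 2) ℂ) *ᵥ v₀))
        (fun _ ↦ mfderiv 𝓘(ℝ, Fin 2 → ℂ) 𝓘(ℝ, (A q).model) (⇑(A q).isAnalytification.homeomorph.symm ∘ (B q).unif)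
          ((g : Matrix (Fin 2) (Fin 2) ℂ) *ᵥ v₀) ((g : Matrix (Fin 2) (Fin 2) ℂ) *ᵥ t₀)) = 0) :
    z = 0 := by
  refine complexBetti_eq_zero_of_forall_map_inj hcol fun q ↦ ?_
  have hv₀' : v₀ ∈ (B q).cone := by
    show v₀ ∈ negCone (B q).Hℂ
    rw [hH q]
    exact hv₀
  refine (B q).eq_zero_of_forall_coneRead_unitary_eq_zero (A q) (hcl q) hv₀' hvt _ (fun g hg ↦ h10 q g ?_) (fun g hg ↦ ?_)
  · rw [← hH q]; exact hg
  · rw [conjClass_complexBetti_map]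
    rw [hH q] at hg
    exact h01 q g hg

/-! ### §2 R6c at the record level, frame currency of ★ `lift_mem_cohForms₂` -/

/-- **R6c (record level, cone-frame currency).**  As `complexBetti_eq_zero_of_forall_coneRead_archLocal_eq_zero`, with the frame given as the
untwist `(v₀, t₀)` of a cone frame `𝔣 : ConeFrame L J⋆ (cmPlace L τ)` (`𝔣.v₀ = embTwist ∘ v₀`, `𝔣.t₀ = embTwist ∘ t₀`), the binders under which
the adelic lifts of the cone-read families lie in `cohForms₂ 𝔣` (★ `lift_mem_cohForms₂`). [cite: Borel1997, §5.14]
[cite: VoisinHodgeI2002, §6.1.3 Cor. 6.14] [cite: HatcherAT2002, §3.1 p. 202] -/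
theorem complexBetti_eq_zero_of_forall_coneRead_archLocal_eq_zero_of_coneFrame (hcol : IsColimit (Cofan.mk M' ι))
    (B : ∀ q, UnitaryBallUniformisationDatum 1 (X q)) (hH : ∀ q, (B q).Hℂ = Jstar.map τ)
    (A : ∀ q, HodgeModel 1 (X q)) (hcl : ∀ q, (A q).HolFormsClosed 1)
    (𝔣 : ConeFrame L Jstar (cmPlace L τ)) {v₀ t₀ : Fin 2 → ℂ}
    (hv : 𝔣.v₀ = fun i => embTwist L τ (v₀ i)) (ht : 𝔣.t₀ = fun i => embTwist L τ (t₀ i)) (z : complexBetti M' 1)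
    (h10 : ∀ (q : Q) (u : archLocal L 2 Jstar (cmPlace L τ)),
      (((A q).oneFormOfClass (B q).isSmoothProjective (hcl q)
            (((A q).complexification (B q).isSmoothProjective 1).symm
              ((A q).pullbackEquiv 1 ((A q).typeProj 1 ⟨(1, 0), Finset.HasAntidiagonal.mem_antidiagonal.2 rfl⟩
                (complexBetti.map (ι q) 1 z))))) :
          MForm 𝓘(ℝ, (A q).model) (A q).carrier ℂ 1)
        ((⇑(A q).isAnalytification.homeomorph.symm ∘ (B q).unif)
          ((((u : GL (Fin 2) ℂ) : Matrix (Fin 2) (Fin 2) ℂ).map (embTwist L τ)) *ᵥ v₀))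
        (fun _ ↦ mfderiv 𝓘(ℝ, Fin 2 → ℂ) 𝓘(ℝ, (A q).model) (⇑(A q).isAnalytification.homeomorph.symm ∘ (B q).unif)
          ((((u : GL (Fin 2) ℂ) : Matrix (Fin 2) (Fin 2) ℂ).map (embTwist L τ)) *ᵥ v₀)
          ((((u : GL (Fin 2) ℂ) : Matrix (Fin 2) (Fin 2) ℂ).map (embTwist L τ)) *ᵥ t₀)) = 0)
    (h01 : ∀ (q : Q) (u : archLocal L 2 Jstar (cmPlace L τ)),
      (((A q).oneFormOfClass (B q).isSmoothProjective (hcl q)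
            (((A q).complexification (B q).isSmoothProjective 1).symm
              ((A q).pullbackEquiv 1 ((A q).typeProj 1 ⟨(1, 0), Finset.HasAntidiagonal.mem_antidiagonal.2 rfl⟩
                (complexBetti.map (ι q) 1 (conjClass (ComplexPoints M') 1 z)))))) :
          MForm 𝓘(ℝ, (A q).model) (A q).carrier ℂ 1)
        ((⇑(A q).isAnalytification.homeomorph.symm ∘ (B q).unif)
          ((((u : GL (Fin 2) ℂ) : Matrix (Fin 2) (Fin 2) ℂ).map (embTwist L τ)) *ᵥ v₀))
        (fun _ ↦ mfderiv 𝓘(ℝ, Fin 2 → ℂ) 𝓘(ℝ, (A q).model) (⇑(A q).isAnalytification.homeomorph.symm ∘ (B q).unif)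
          ((((u : GL (Fin 2) ℂ) : Matrix (Fin 2) (Fin 2) ℂ).map (embTwist L τ)) *ᵥ v₀)
          ((((u : GL (Fin 2) ℂ) : Matrix (Fin 2) (Fin 2) ℂ).map (embTwist L τ)) *ᵥ t₀)) = 0) :
    z = 0 :=
  complexBetti_eq_zero_of_forall_coneRead_archLocal_eq_zero hcol B hH A hcl (coneFrame_untwist_mem_negCone 𝔣 hv)
    (coneFrame_untwist_ne_smul 𝔣 hv ht) z h10 h01

end Summit.HodgeConjecture.HodgeConjecture.Cruxes.HLiu418.RecordClassDetection

end
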